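import Literature.MathematicalPhysics.KineticTheory.EvenCollisionTubeFunctional
import Literature.MathematicalPhysics.KineticTheory.HardSphereEulerProofs
import Literature.MathematicalPhysics.StatisticalMechanics.HardSphereContactTheorem
import HarnessLib

/-!
# The canonical contact theorem: named fact (configurational form) ⇒ the phase-space form used by H5/H6

Crux stmt-AtomisticToContinuum-13079 (`JParityClosure.EvenStressEnskog`), line `even-rung-mean-variance`.  The registered helper
stubs H5 `stub_tubeMeanRung0OfContact` and H6 `stub_meanEnskogRung0OfContact` carry the canonical contact theorem as an explicit
antecedent, written on the rung-0 phase-space local Gibbs law (constant profiles `a, u, θ`, any hard-sphere flow `Φ`).  The Literature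
named fact `Literature.MathematicalPhysics.StatisticalMechanics.HardSphereContactTheorem` states it on the configurational canonical
measure `posGibbsMeasure 1 ε (N+1)`.  `contactStatementLG_of_contactTheorem` bridges the two: the event only involves positions, the
position marginal of the local Gibbs law is `posGibbsMeasure a ε (N+1)` (`localGibbsMeasure_preimage_pos`), and a constant activity
does not change the normalised configurational measure (`posGibbsMeasure_const`).
-/

noncomputable section

open MeasureTheory Set Filter Topology
open scoped ENNReal Pointwise

namespace Summit.AtomisticToContinuum.HydrodynamicLimit.Theorems.EvenStressEnskog

open Literature.Analysis.FluidPDE Literature.MathematicalPhysics.KineticTheory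

/-- A constant activity does not change the configurational canonical measure. [folklore] -/
theorem posGibbsMeasure_const (a : ℝ) (ha : 0 < a) (ε : ℝ) (n : ℕ) :
    posGibbsMeasure (fun _ => a) ε n = posGibbsMeasure (fun _ => (1 : ℝ)) ε n := by
  have han : a ^ n ≠ 0 := pow_ne_zero n ha.ne'
  have hW : ∀ x : Fin n → T3, posWeight (fun _ => a) ε n x = a ^ n * posWeight (fun _ => (1 : ℝ)) ε n x := by
    intro x
    unfold posWeight
    by_cases hx : x ∈ posDomain ε n
    · rw [indicator_of_mem hx, indicator_of_mem hx]
      simp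
    · rw [indicator_of_notMem hx, indicator_of_notMem hx, mul_zero]
  have hP : posPartition (fun _ => a) ε n = a ^ n * posPartition (fun _ => (1 : ℝ)) ε n := by
    unfold posPartition
    rw [← integral_const_mul]
    exact integral_congr_ae (Eventually.of_forall hW)
  unfold posGibbsMeasure
  congr 1
  funext x
  rw [hW x, hP, mul_inv, mul_mul_mul_comm, inv_mul_cancel₀ han, one_mul]

/-- The relative-position event is measurable. [folklore] -/
theorem measurableSet_reprSym_sub_mem {n : ℕ} (i j : Fin n) {T : Set V3} (hT : MeasurableSet T) :
    MeasurableSet {x : Fin n → T3 | Torus.reprSym (x i - x j) ∈ T} :=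
  (Torus.measurable_reprSym.comp ((measurable_pi_apply i).sub (measurable_pi_apply j))) hT

/-- **Bridge**: the canonical contact theorem (named fact `HardSphereContactTheorem`, configurational form, activity `1`) implies the
phase-space form used as antecedent by H5/H6: the event only involves positions, the position marginal of the rung-0 local Gibbs law
is `posGibbsMeasure a ε (N+1)` (`localGibbsMeasure_preimage_pos`), and a constant activity does not change it. -/
theorem contactStatementLG_of_contactTheorem :
    Literature.MathematicalPhysics.StatisticalMechanics.HardSphereContactTheorem →
    ∃ σ₁ : ℝ, 0 < σ₁ ∧ ∀ σ : ℝ, 0 < σ → σ < σ₁ → ∀ ζ : ℝ, 0 < ζ → ∃ δ₁ : ℝ, 0 < δ₁ ∧ ∀ δ : ℝ, 0 < δ → δ ≤ δ₁ →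
      ∃ N₀ : ℕ, ∀ N : ℕ, N₀ ≤ N → ∀ (a θ : ℝ) (u : V3), 0 < a → 0 < θ →
      ∀ Φ : HardSphereFlow (Torus.geometry (Fin 3)) (hsDiameter σ N) (N + 1),
      ∀ i j : Fin (N + 1), i ≠ j → ∀ S : Set V3, MeasurableSet S → S ⊆ {q | 1 < ‖q‖ ∧ ‖q‖ ≤ 1 + δ} →
        |(localGibbsLaw σ (fun _ => a) (fun _ => u) (fun _ => θ) N Φ).real
            {z | Torus.reprSym ((z i).1 - (z j).1) ∈ hsDiameter σ N • S}
          - contactValue (σ ^ 3) * hsDiameter σ N ^ 3 * (volume S).toReal|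
          ≤ ζ * hsDiameter σ N ^ 3 * (volume S).toReal := by
  intro h
  obtain ⟨σ₁, hσ₁, h⟩ := h
  refine ⟨σ₁, hσ₁, fun σ hσ hσlt ζ hζ => ?_⟩
  obtain ⟨δ₁, hδ₁, h⟩ := h σ hσ hσlt ζ hζ
  refine ⟨δ₁, hδ₁, fun δ hδ hδle => ?_⟩
  obtain ⟨N₀, h⟩ := h δ hδ hδle
  refine ⟨N₀, fun N hN a θ u ha hθ Φ i j hij S hS hSsub => ?_⟩
  have key := h N hN i j hij S hS hSsub
  have hε : hsDiameter σ N ≠ 0 := (hsDiameter_pos hσ N).ne'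
  have hT : MeasurableSet (hsDiameter σ N • S) := hS.const_smul_of_ne_zero hε
  have hS' := measurableSet_reprSym_sub_mem (n := N + 1) i j hT
  have hset : {z : Config (N + 1) (Fin 3) T3 | Torus.reprSym ((z i).1 - (z j).1) ∈ hsDiameter σ N • S}
      = (fun z : Config (N + 1) (Fin 3) T3 => fun k => (z k).1) ⁻¹'
          {x : Fin (N + 1) → T3 | Torus.reprSym (x i - x j) ∈ hsDiameter σ N • S} := rfl
  have hmeas : (localGibbsLaw σ (fun _ => a) (fun _ => u) (fun _ => θ) N Φ)
      {z | Torus.reprSym ((z i).1 - (z j).1) ∈ hsDiameter σ N • S}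
      = (posGibbsMeasure (fun _ => (1 : ℝ)) (hsDiameter σ N) (N + 1))
          {x | Torus.reprSym (x i - x j) ∈ hsDiameter σ N • S} := by
    rw [hset, localGibbsLaw_eq,
      localGibbsMeasure_preimage_pos continuous_const continuous_const continuous_const
        (fun _ => ha.le) (fun _ => hθ) σ N hS',
      posGibbsMeasure_const a ha]
  rw [measureReal_def, hmeas, ← measureReal_def]
  exact key


end Summit.AtomisticToContinuum.HydrodynamicLimit.Theorems.EvenStressEnskog

end
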